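import Literature.ModelTheory.ExponentialFields.OMinimalPregeometry
import Mathlib.ModelTheory.ElementarySubstructures
import HarnessLib

/-!
# The definable closure is an elementary substructure (o-minimal structures with dense `dcl`)

Topic `Literature/ModelTheory/ExponentialFields`.  For an `L`-structure `M` the definable
closure `dcl(A)` (`DefinableClosure.lean`) is always (the carrier of) a substructure
(`definableClosureSubstructure`).  When `M` is o-minimal and `dcl` is *dense* in the sense that
between any two points, above and below any point, and in `M` itself there are points
definable from those points — as in every o-minimal expansion of an ordered field, where
`(a + b)/2`, `a ± 1`, `0` serve — then every non-empty `A`-definable subset of `M` meets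
`dcl(A)` (`exists_mem_definableClosure_of_nonempty`: its finitely many boundary points are in
`dcl(A)`, and between consecutive boundary points the set is constant), so by the
Tarski–Vaught test (Mathlib's `Substructure.isElementary_of_exists`) **`dcl(A) ≼ M`**
(`isElementary_definableClosureSubstructure`).  This is den Besten 2016, Lemma 4.4.2 / Remark
7.1.4 ("`Dcl(A) ⪯ K`", there for expansions of the real field, via definable Skolem functions;
van den Dries 1998, Ch. 6, (1.2)–(1.3), definable choice ⇒ definable Skolem functions), in the
form needed for the dimension arguments of den Besten §7.1 / Wilkie 1996 §10.

* `definableClosureSubstructure L A`, `Ioo_subset_of_forall_not_boundary` (between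
  non-boundary points a definable set is constant), `exists_mem_definableClosure_of_nonempty`,
  `isElementary_definableClosureSubstructure`.

Nothing here is a named fact.

## References

* [DenBesten2016] M. den Besten, *Wilkie's Theorem and the Uniform Real Schanuel Conjecture*,
  MSc thesis, Utrecht 2016, Lemma 4.4.2, Remark 7.1.4.
* [Dries1998] L. van den Dries, *Tame topology and o-minimal structures*, CUP 1998, Ch. 1,
  (3.3); Ch. 6, (1.2)–(1.3).
* [Marker2002] D. Marker, *Model Theory: An Introduction*, GTM 217, Prop. 2.3.5 (Tarski–Vaught).
-/

open Set FirstOrder FirstOrder.Language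

namespace Literature.ModelTheory.ExponentialFields

universe u v

variable (L : Language.{u, v}) {M : Type*} [L.Structure M]

/-! ### `dcl(A)` as a substructure -/

/-- The value of a function symbol at a tuple is definable over the entries of the tuple.
[folklore] -/
theorem funMap_mem_definableClosure_range {n : ℕ} (f : L.Functions n) (x : Fin n → M) :
    Structure.funMap f x ∈ definableClosure L (range x) := by
  rw [mem_definableClosure_iff, Set.Definable₁, Set.definable_iff_exists_formula_sum]
  refine ⟨(Term.var (Sum.inr 0)).equal
    (Term.func f fun i => Term.var (Sum.inl ⟨x i, mem_range_self i⟩)), ?_⟩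
  ext v
  simp only [mem_setOf_eq, mem_singleton_iff, Formula.realize_equal, Term.realize_var,
    Sum.elim_inr, Term.realize_func, Sum.elim_inl]

/-- **`dcl(A)` is a substructure**: the definable closure is closed under the function
symbols of `L` (Marker 2002, Exercise 1.4.10; den Besten 2016, Remark 7.1.4).  A `def`
packaging `definableClosure L A` as an `L.Substructure M`. [cite: Marker2002, Exercise 1.4.10] -/
def definableClosureSubstructure (A : Set M) : L.Substructure M where
  carrier := definableClosure L A
  fun_mem := fun {_} f x hx =>
    definableClosure_subset_of_subset (L := L)
      (fun z hz => by obtain ⟨i, rfl⟩ := hz; exact hx i)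
      (funMap_mem_definableClosure_range L f x)

variable {L}

/-- The carrier of `definableClosureSubstructure L A` is `dcl(A)`. [folklore] -/
@[simp]
theorem coe_definableClosureSubstructure (A : Set M) :
    ((definableClosureSubstructure L A : L.Substructure M) : Set M) = definableClosure L A :=
  rfl

/-- Membership in `definableClosureSubstructure L A` is membership in `dcl(A)`. [folklore] -/
@[simp]
theorem mem_definableClosureSubstructure {A : Set M} {b : M} :
    b ∈ definableClosureSubstructure L A ↔ b ∈ definableClosure L A :=
  Iff.rfl

/-- The set defined by a bounded formula with parameters from a substructure `S`, in its last
variable, is definable over (the carrier of) `S` — the bookkeeping step of the Tarski–Vaught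
test. [folklore] -/
theorem definable₁_setOf_realize_snoc (S : L.Substructure M) {n : ℕ}
    (φ : L.BoundedFormula Empty (n + 1)) (x : Fin n → S) :
    (S : Set M).Definable₁ L {b : M | φ.Realize default (Fin.snoc ((↑) ∘ x) b : _ → M)} := by
  rw [Set.Definable₁, Set.definable_iff_exists_formula_sum]
  let r : Empty ⊕ Fin (n + 1) → ↥(S : Set M) ⊕ Fin 1 :=
    Sum.elim Empty.elim (Fin.snoc (fun j => Sum.inl ⟨(x j : M), (x j).2⟩) (Sum.inr 0))
  refine ⟨φ.toFormula.relabel r, ?_⟩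
  ext v
  simp only [mem_setOf_eq, Formula.realize_relabel, BoundedFormula.realize_toFormula]
  have h₁ : ((Sum.elim (fun p : ↥(S : Set M) => (p : M)) v ∘ r) ∘ Sum.inl) =
      (default : Empty → M) := Subsingleton.elim _ _
  have h₂ : ((Sum.elim (fun p : ↥(S : Set M) => (p : M)) v ∘ r) ∘ Sum.inr) =
      (Fin.snoc ((↑) ∘ x) (v 0) : Fin (n + 1) → M) := by
    funext i
    refine Fin.lastCases ?_ (fun j => ?_) i
    · simp [r]
    · simp [r]
  rw [h₁, h₂]

/-! ### Between non-boundary points a definable set is constant -/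

section OMinimal

variable [LinearOrder M] [DenselyOrdered M] [NoMinOrder M] [NoMaxOrder M]

/-- In an o-minimal structure, if an open interval `(p, q)` contains no boundary point of the
definable set `S` (no point every neighbourhood of which meets both `S` and its complement)
and contains a point of `S`, then `(p, q) ⊆ S` (van den Dries 1998, Ch. 1, (3.3)(ii): the set
is constant between consecutive boundary points; proved with the definable supremum of the
initial segment of `S` starting at the given point). [cite: Dries1998, Ch. 1 (3.3)(ii)] -/
theorem Ioo_subset_of_forall_not_boundary (hO : L.IsOMinimal M)
    (hlt : (univ : Set M).Definable L {v : Fin 2 → M | v 0 < v 1})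
    {S : Set M} (hS : (univ : Set M).Definable₁ L S) {p q x : M} (hx : x ∈ Ioo p q)
    (hxS : x ∈ S)
    (hbd : ∀ z ∈ Ioo p q, ¬ ∀ c₁ c₂, c₁ < z → z < c₂ →
      (∃ y, c₁ < y ∧ y < c₂ ∧ y ∈ S) ∧ (∃ y, c₁ < y ∧ y < c₂ ∧ y ∉ S)) :
    Ioo p q ⊆ S := by
  have hmem : ∀ {β : Type} (t : (β → M) → M), (univ : Set M).DefinableFun L t →
      (univ : Set M).Definable L {w : β → M | t w ∈ S} := fun t ht => by
    have h := hS.preimage_map (F := fun w (_ : Fin 1) => t w) (fun _ => ht)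
    exact h
  intro y hy
  by_contra hyS
  rcases lt_or_gt_of_ne (fun h : x = y => hyS (h ▸ hxS)) with hxy | hyx
  · -- `x < y`: the supremum of the initial segment of `S` after `x` is a boundary point
    set T : Set M := {w | x ≤ w ∧ w ≤ y ∧ ∀ u, x ≤ u → u ≤ w → u ∈ S} with hT
    have hTdef : IsFiniteUnionOfIntervals T := by
      apply isFiniteUnionOfIntervals_setOf hO
      refine definable_setOf_and (definable_setOf_le hlt (definableFun_const' _ x)
        (definableFun_proj _)) ?_
      refine definable_setOf_and (definable_setOf_le hlt (definableFun_proj _)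
        (definableFun_const' _ y)) ?_
      apply definable_setOf_forall
      refine definable_setOf_imp (definable_setOf_le hlt (definableFun_const' _ x)
        (definableFun_proj _)) ?_
      refine definable_setOf_imp (definable_setOf_le hlt (definableFun_proj _)
        (definableFun_proj _)) ?_
      exact hmem _ (definableFun_proj _)
    have hxT : x ∈ T := ⟨le_rfl, hxy.le, fun u hu₁ hu₂ => (le_antisymm hu₂ hu₁) ▸ hxS⟩
    obtain ⟨z, hz⟩ := hTdef.exists_isLUB ⟨x, hxT⟩ ⟨y, fun w hw => hw.2.1⟩
    have hxz : x ≤ z := hz.1 hxT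
    have hzy : z ≤ y := hz.2 fun w hw => hw.2.1
    refine hbd z ⟨hx.1.trans_le hxz, hzy.trans_lt hy.2⟩ fun c₁ c₂ hc₁ hc₂ => ⟨?_, ?_⟩
    · obtain ⟨w, hwT, hc₁w, hwz⟩ := hz.exists_between hc₁
      exact ⟨w, hc₁w, hwz.trans_lt hc₂, hwT.2.2 w hwT.1 le_rfl⟩
    · by_contra hall
      have hall' : ∀ y', c₁ < y' → y' < c₂ → y' ∈ S := fun y' h₁ h₂ => by
        by_contra h; exact hall ⟨y', h₁, h₂, h⟩
      rcases hzy.lt_or_eq with hzy' | hzy'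
      · obtain ⟨w', hzw', hw'⟩ := exists_between (lt_min hc₂ hzy')
        have hw'T : w' ∈ T := by
          refine ⟨hxz.trans hzw'.le, (lt_of_lt_of_le hw' (min_le_right _ _)).le,
            fun u hu₁ hu₂ => ?_⟩
          rcases lt_or_ge u z with huz | hzu
          · obtain ⟨w, hwT, huw, -⟩ := hz.exists_between huz
            exact hwT.2.2 u hu₁ huw.le
          · exact hall' u (hc₁.trans_le hzu) (hu₂.trans_lt (lt_of_lt_of_le hw' (min_le_left _ _)))
        exact (not_le.2 hzw') (hz.1 hw'T)
      · exact hyS (hall' y (hzy' ▸ hc₁) (hzy' ▸ hc₂))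
  · -- `y < x`: the infimum of the final segment of `S` before `x` is a boundary point
    set T : Set M := {w | y ≤ w ∧ w ≤ x ∧ ∀ u, w ≤ u → u ≤ x → u ∈ S} with hT
    have hTdef : IsFiniteUnionOfIntervals T := by
      apply isFiniteUnionOfIntervals_setOf hO
      refine definable_setOf_and (definable_setOf_le hlt (definableFun_const' _ y)
        (definableFun_proj _)) ?_
      refine definable_setOf_and (definable_setOf_le hlt (definableFun_proj _)
        (definableFun_const' _ x)) ?_
      apply definable_setOf_forall
      refine definable_setOf_imp (definable_setOf_le hlt (definableFun_proj _)
        (definableFun_proj _)) ?_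
      refine definable_setOf_imp (definable_setOf_le hlt (definableFun_proj _)
        (definableFun_const' _ x)) ?_
      exact hmem _ (definableFun_proj _)
    have hxT : x ∈ T := ⟨hyx.le, le_rfl, fun u hu₁ hu₂ => (le_antisymm hu₂ hu₁) ▸ hxS⟩
    obtain ⟨z, hz⟩ := hTdef.exists_isGLB ⟨x, hxT⟩ ⟨y, fun w hw => hw.1⟩
    have hzx : z ≤ x := hz.1 hxT
    have hyz : y ≤ z := hz.2 fun w hw => hw.1
    refine hbd z ⟨hy.1.trans_le hyz, hzx.trans_lt hx.2⟩ fun c₁ c₂ hc₁ hc₂ => ⟨?_, ?_⟩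
    · obtain ⟨w, hwT, hzw, hwc₂⟩ := hz.exists_between hc₂
      exact ⟨w, hc₁.trans_le hzw, hwc₂, hwT.2.2 w le_rfl hwT.2.1⟩
    · by_contra hall
      have hall' : ∀ y', c₁ < y' → y' < c₂ → y' ∈ S := fun y' h₁ h₂ => by
        by_contra h; exact hall ⟨y', h₁, h₂, h⟩
      rcases hyz.lt_or_eq with hyz' | hyz'
      · obtain ⟨w', hw', hw'z⟩ := exists_between (max_lt hc₁ hyz')
        have hw'T : w' ∈ T := by
          refine ⟨(lt_of_le_of_lt (le_max_right _ _) hw').le, hw'z.le.trans hzx,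
            fun u hu₁ hu₂ => ?_⟩
          rcases lt_or_ge z u with hzu | huz
          · obtain ⟨w, hwT, -, hwu⟩ := hz.exists_between hzu
            exact hwT.2.2 u hwu.le hu₂
          · exact hall' u ((lt_of_le_of_lt (le_max_left _ _) hw').trans_le hu₁)
              (huz.trans_lt hc₂)
        exact (not_le.2 hw'z) (hz.1 hw'T)
      · exact hyS (hall' y (hyz'.symm ▸ hc₁) (hyz'.symm ▸ hc₂))

/-- **Every non-empty `A`-definable subset of the line meets `dcl(A)`**, in an o-minimal
structure whose definable closure is dense: between two points, above and below a point, and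
somewhere, there are points definable from those points (van den Dries 1998, Ch. 6, (1.2)–(1.3):
definable choice / definable Skolem functions for o-minimal expansions of ordered groups, here
axiomatised by its one-variable consequences; den Besten 2016, Lemma 4.4.2).  Proof: the
boundary of the set is a finite `A`-definable set, so it lies in `dcl(A)`; if no boundary
point is in the set, the set contains the whole gap between consecutive boundary points around
any of its points, and that gap contains a point of `dcl(A)` by density. [cite: DenBesten2016, Lemma 4.4.2] -/
theorem exists_mem_definableClosure_of_nonempty (hO : L.IsOMinimal M)
    (hlt₀ : (∅ : Set M).Definable L {v : Fin 2 → M | v 0 < v 1})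
    (hmid : ∀ a b : M, a < b → ∃ c ∈ definableClosure L ({a, b} : Set M), a < c ∧ c < b)
    (hgt : ∀ a : M, ∃ c ∈ definableClosure L ({a} : Set M), a < c)
    (hlt : ∀ a : M, ∃ c ∈ definableClosure L ({a} : Set M), c < a)
    (hne : (definableClosure L (∅ : Set M)).Nonempty)
    {A : Set M} {S : Set M} (hS : A.Definable₁ L S) (hSne : S.Nonempty) :
    ∃ c ∈ definableClosure L A, c ∈ S := by
  classical
  have hltA : A.Definable L {v : Fin 2 → M | v 0 < v 1} := hlt₀.mono (empty_subset _)
  have hltU : (univ : Set M).Definable L {v : Fin 2 → M | v 0 < v 1} :=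
    hlt₀.mono (empty_subset _)
  -- the boundary of `S`
  set Bd : Set M := {x | ∀ c₁ c₂, c₁ < x → x < c₂ →
    (∃ y, c₁ < y ∧ y < c₂ ∧ y ∈ S) ∧ (∃ y, c₁ < y ∧ y < c₂ ∧ y ∉ S)} with hBd
  have hBdfin : Bd.Finite := finite_setOf_boundary (isFiniteUnionOfIntervals_setOf_params hO hS)
  have hBddcl : Bd ⊆ definableClosure L A :=
    subset_definableClosure_of_finite hltA (S := Bd) (definable_setOf_boundary hltA hS) hBdfin
  by_cases h₁ : ∃ c ∈ Bd, c ∈ S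
  · obtain ⟨c, hc, hcS⟩ := h₁
    exact ⟨c, hBddcl hc, hcS⟩
  have h₁' : ∀ c ∈ Bd, c ∉ S := fun c hc hcS => h₁ ⟨c, hc, hcS⟩
  obtain ⟨x, hxS⟩ := hSne
  have hxBd : x ∉ Bd := fun h => h₁' x h hxS
  -- constancy of `S` on intervals around `x` avoiding `Bd`
  have hconst : ∀ p q, p < x → x < q → (∀ z ∈ Bd, z ∉ Ioo p q) → Ioo p q ⊆ S :=
    fun p q hp hq havoid => Ioo_subset_of_forall_not_boundary hO hltU
      (hS.mono (subset_univ A)) ⟨hp, hq⟩ hxS fun z hz hzBd => havoid z hzBd hz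
  -- absorbing `dcl` of points of `dcl(A)`
  have habs : ∀ B : Set M, B ⊆ definableClosure L A → definableClosure L B ⊆
      definableClosure L A := fun B hB => definableClosure_subset_of_subset hB
  set F := hBdfin.toFinset with hF
  have hmemF : ∀ z, z ∈ F ↔ z ∈ Bd := fun z => hBdfin.mem_toFinset
  by_cases hP : (F.filter fun z => z < x).Nonempty <;>
    by_cases hQ : (F.filter fun z => x < z).Nonempty
  · -- boundary points on both sides: use the midpoint-like definable point
    set p := (F.filter fun z => z < x).max' hP
    set q := (F.filter fun z => x < z).min' hQ
    have hp : p ∈ Bd ∧ p < x := by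
      have h := Finset.mem_filter.1 (Finset.max'_mem _ hP); exact ⟨(hmemF p).1 h.1, h.2⟩
    have hq : q ∈ Bd ∧ x < q := by
      have h := Finset.mem_filter.1 (Finset.min'_mem _ hQ); exact ⟨(hmemF q).1 h.1, h.2⟩
    have havoid : ∀ z ∈ Bd, z ∉ Ioo p q := by
      intro z hz hzI
      rcases lt_trichotomy z x with hzx | rfl | hxz
      · exact (not_lt.2 (Finset.le_max' _ z (Finset.mem_filter.2 ⟨(hmemF z).2 hz, hzx⟩))) hzI.1
      · exact hxBd hz
      · exact (not_lt.2 (Finset.min'_le _ z (Finset.mem_filter.2 ⟨(hmemF z).2 hz, hxz⟩))) hzI.2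
    obtain ⟨c, hc, hpc, hcq⟩ := hmid p q (hp.2.trans hq.2)
    refine ⟨c, habs _ ?_ hc, hconst p q hp.2 hq.2 havoid ⟨hpc, hcq⟩⟩
    intro z hz
    rcases hz with rfl | rfl
    · exact hBddcl hp.1
    · exact hBddcl hq.1
  · -- boundary points only below `x`
    set p := (F.filter fun z => z < x).max' hP
    have hp : p ∈ Bd ∧ p < x := by
      have h := Finset.mem_filter.1 (Finset.max'_mem _ hP); exact ⟨(hmemF p).1 h.1, h.2⟩
    obtain ⟨c, hc, hpc⟩ := hgt p
    obtain ⟨q, hq⟩ := exists_gt (max x c)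
    have havoid : ∀ z ∈ Bd, z ∉ Ioo p q := by
      intro z hz hzI
      rcases lt_trichotomy z x with hzx | rfl | hxz
      · exact (not_lt.2 (Finset.le_max' _ z (Finset.mem_filter.2 ⟨(hmemF z).2 hz, hzx⟩))) hzI.1
      · exact hxBd hz
      · exact hQ ⟨z, Finset.mem_filter.2 ⟨(hmemF z).2 hz, hxz⟩⟩
    refine ⟨c, habs _ (fun z hz => ?_) hc,
      hconst p q hp.2 (lt_of_le_of_lt (le_max_left _ _) hq) havoid
        ⟨hpc, lt_of_le_of_lt (le_max_right _ _) hq⟩⟩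
    rw [mem_singleton_iff.1 hz]; exact hBddcl hp.1
  · -- boundary points only above `x`
    set q := (F.filter fun z => x < z).min' hQ
    have hq : q ∈ Bd ∧ x < q := by
      have h := Finset.mem_filter.1 (Finset.min'_mem _ hQ); exact ⟨(hmemF q).1 h.1, h.2⟩
    obtain ⟨c, hc, hcq⟩ := hlt q
    obtain ⟨p, hp⟩ := exists_lt (min x c)
    have havoid : ∀ z ∈ Bd, z ∉ Ioo p q := by
      intro z hz hzI
      rcases lt_trichotomy z x with hzx | rfl | hxz
      · exact hP ⟨z, Finset.mem_filter.2 ⟨(hmemF z).2 hz, hzx⟩⟩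
      · exact hxBd hz
      · exact (not_lt.2 (Finset.min'_le _ z (Finset.mem_filter.2 ⟨(hmemF z).2 hz, hxz⟩))) hzI.2
    refine ⟨c, habs _ (fun z hz => ?_) hc,
      hconst p q (lt_of_lt_of_le hp (min_le_left _ _)) hq.2 havoid
        ⟨lt_of_lt_of_le hp (min_le_right _ _), hcq⟩⟩
    rw [mem_singleton_iff.1 hz]; exact hBddcl hq.1
  · -- no boundary points at all: `S = M`
    obtain ⟨c, hc⟩ := hne
    obtain ⟨p, hp⟩ := exists_lt (min x c)
    obtain ⟨q, hq⟩ := exists_gt (max x c)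
    have havoid : ∀ z ∈ Bd, z ∉ Ioo p q := by
      intro z hz _
      rcases lt_trichotomy z x with hzx | rfl | hxz
      · exact hP ⟨z, Finset.mem_filter.2 ⟨(hmemF z).2 hz, hzx⟩⟩
      · exact hxBd hz
      · exact hQ ⟨z, Finset.mem_filter.2 ⟨(hmemF z).2 hz, hxz⟩⟩
    refine ⟨c, definableClosure_mono (empty_subset A) hc,
      hconst p q (lt_of_lt_of_le hp (min_le_left _ _)) (lt_of_le_of_lt (le_max_left _ _) hq)
        havoid ⟨lt_of_lt_of_le hp (min_le_right _ _), lt_of_le_of_lt (le_max_right _ _) hq⟩⟩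

/-- **`dcl(A)` is an elementary substructure** (den Besten 2016, Lemma 4.4.2 and Remark 7.1.4:
"`Dcl(A) ⪯ K`"; van den Dries 1998, Ch. 6, (1.2)–(1.3)), for an o-minimal structure on a dense
linear order without endpoints with `<` definable without parameters, whose definable closure
is dense (points definable between, above, below, and from nothing — e.g. any o-minimal
expansion of an ordered field).  By the Tarski–Vaught test: a formula with parameters in
`dcl(A)` satisfied in `M` defines a non-empty `dcl(A)`-definable set, which meets
`dcl(dcl(A)) = dcl(A)`. [cite: DenBesten2016, Lemma 4.4.2] -/
theorem isElementary_definableClosureSubstructure (hO : L.IsOMinimal M)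
    (hlt₀ : (∅ : Set M).Definable L {v : Fin 2 → M | v 0 < v 1})
    (hmid : ∀ a b : M, a < b → ∃ c ∈ definableClosure L ({a, b} : Set M), a < c ∧ c < b)
    (hgt : ∀ a : M, ∃ c ∈ definableClosure L ({a} : Set M), a < c)
    (hlt : ∀ a : M, ∃ c ∈ definableClosure L ({a} : Set M), c < a)
    (hne : (definableClosure L (∅ : Set M)).Nonempty) (A : Set M) :
    (definableClosureSubstructure L A).IsElementary := by
  refine Substructure.isElementary_of_exists _ fun n φ x a ha => ?_
  have hdef := definable₁_setOf_realize_snoc (definableClosureSubstructure L A) φ x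
  obtain ⟨c, hc, hcS⟩ := exists_mem_definableClosure_of_nonempty hO hlt₀ hmid hgt hlt hne
    hdef ⟨a, ha⟩
  rw [coe_definableClosureSubstructure, definableClosure_definableClosure] at hc
  exact ⟨⟨c, hc⟩, hcS⟩

end OMinimal

end Literature.ModelTheory.ExponentialFields
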